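import Summits.BirchSwinnertonDyer.Rank1Residual.Additive.KatoDescentLocPKummerLattice
import Summits.BirchSwinnertonDyer.BirchSwinnertonDyer.Theorems.CongruentShaFreeCutKatoKummerLogTorsion
import Literature.NumberTheory.EllipticCurves.LocalKummerMap
import Literature.NumberTheory.EllipticCurves.Kato2004.IwasawaCohomology
import HarnessLib

/-!
# Route `ErratumRoadFive`, crux `EulerHalfNotRamNoInertSetAtFive` (stmt-BirchSwinnertonDyer-19715), line `kato_Fframe`
# (registered r5.2 `Cruxes/EulerHalfNotRamNoInertSetAtFive/Lines/kato_Fframe_r5.lean` cf457b9468bcf978), stub S1Λ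
# `stub_katoLambdaLogBoundTamagawa` — HELPER hnt: **a class with a NON-ZERO Kummer logarithm at `p` has infinite order**
# (`HasLocPKummerLog W p x t ∧ t ≠ 0 ⟹ ¬ IsOfFinAddOrder x`), and its bottom-layer form for a pinned `𝐇¹_Γ(T_pW)`

LEAD seat `bsd-line-er5-p1` (g8), `--supports stmt-BirchSwinnertonDyer-19715`; theorems only (no definition, no named fact,
no `sorry`); closes nothing. WHY: the rank-one descent P1/P1′ (`Theorems/ErratumRoadFiveKatoFframeFineDescentRankOne.lean`) and
the `𝐇²`-coinvariant index (`…KatoFframeH2CoinvariantsIndex.lean`) take `hnt : ¬ IsOfFinAddOrder (I.proj 0 s)` for the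
admissible class `s = z₀`; in the skeleton's composition the available datum is S1Λ's binder «`HasLocPKummerLog W p
(bottomClass W p K I z₀) t` with `t ≠ 0`» (`t ≠ 0` being S3's / S3ns's output). This file is the bridge — the
ELEMENTARY direction of cn100's reading (3.1″) (`CongruentShaFreeCutKatoKummerLogTorsion` proves the converse
bookkeeping «`t = 0` ⟹ a multiple of `x` dies at `p` levelwise»; `Kato2004.locP_kernel_isTorsion_of_rankOne` the deep converse).

MATHEMATICS. If `n • x = 0` (`n ≥ 1`) and `(m, Q)` witnesses `HasLocPKummerLog W p x t` — `loc_p(m•x) ≡ κ_k(Q)` at every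
level `p^k`, `log_ω Q = m·t` — then `κ_k(n•Q) = loc_p(m•(n•x)) = 0` for every `k`, so `n•Q ∈ p^k·E(ℚ_v)` for every `k`
(exactness of the local Kummer sequence, `ker_localKummerMap`); reading `E(ℚ_v)` through a logarithm `λ` with finite
kernel = torsion and lattice image `ℤ_p·ϖ` (`LocPKummer.exists_lambda_adicCompletion`, AEC IV.6.4 / VII.6.3) the
coordinate of `λ(n•Q)` lies in `⋂_k p^k ℤ_p = 0`, so `n•Q`, hence `Q`, is torsion, `log_ω Q = 0`, `m·t = 0`, `t = 0`.

* §1 `eq_zero_of_forall_mem_span_pow` — `⋂_k p^k ℤ_p = 0` (norm form).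
* §2 `isOfFinAddOrder_of_forall_exists_zsmul_eq` — a point of `E(ℚ_v)` divisible by every `p^k` is torsion.
* §3 **`not_isOfFinAddOrder_of_hasLocPKummerLog_ne_zero`** (`x ∈ H¹(⊤, T_pW)`) and
  **`not_isOfFinAddOrder_proj_zero_of_hasLocPKummerLog_ne_zero`** (the bottom layer `I.proj 0 z₀` of a pinned
  `I : IwasawaH1Data W p κ γ`, moved to `⊤` by `layerZeroToTop` — the shape of S1Λ's `bottomClass`).

References: [BlochKato1990] Ex. 3.11; [SilvermanAEC2009] IV.6.4, VII.6.3, VIII.§2 (local Kummer sequence);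
[AlpogeBhargavaShnidman2022] App. A §10.1.2–10.1.3 (pp. 33–34); [Kato2004Asterisque] §14.14 (14.14.1) (p. 243).
-/

-- the summit and its single problem are both named `BirchSwinnertonDyer` (registry layout D-0017)
set_option linter.dupNamespace false
set_option autoImplicit false

noncomputable section

open scoped Classical NumberField
open Field IsDedekindDomain WeierstrassCurve
open Literature.NumberTheory.EllipticCurves Literature.NumberTheory.EllipticCurves.Kato2004
open Literature.NumberTheory.EllipticCurves.Kato2004.EulerSystemValues
open Literature.NumberTheory.GaloisRepresentations
open Summit.BirchSwinnertonDyer.Rank1Residual.Additive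

namespace Summit.BirchSwinnertonDyer.BirchSwinnertonDyer.Theorems.ErratumRoadFiveKatoFframeKummerLogNonTorsion

/-! ## §1 `⋂_k p^k ℤ_p = 0` -/

/-- An element of `ℤ_p` lying in `p^k ℤ_p` for every `k` is `0` (`‖a‖ ≤ p^{-k}` for all `k`). [folklore] -/
theorem eq_zero_of_forall_mem_span_pow {p : ℕ} [hp : Fact p.Prime] {a : ℤ_[p]}
    (h : ∀ k : ℕ, a ∈ (Ideal.span {(p : ℤ_[p]) ^ k} : Ideal ℤ_[p])) : a = 0 := by
  by_contra ha
  have hnorm : 0 < ‖a‖ := norm_pos_iff.mpr ha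
  -- `‖a‖ ≤ p^{-k}` for every `k`, and `p^{-k} → 0`
  have hle : ∀ k : ℕ, ‖a‖ ≤ (p : ℝ) ^ (-(k : ℤ)) := fun k ↦
    (PadicInt.norm_le_pow_iff_mem_span_pow a k).mpr (h k)
  have hp1 : (1 : ℝ) < p := by exact_mod_cast hp.out.one_lt
  obtain ⟨k, hk⟩ := exists_pow_lt_of_lt_one hnorm (inv_lt_one_of_one_lt₀ hp1)
  have hk' : ((p : ℝ) ^ (-(k : ℤ))) < ‖a‖ := by
    rw [zpow_neg, zpow_natCast, ← inv_pow]
    exact hk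
  exact absurd (hle k) (not_le.mpr hk')

/-! ## §2 A point of `E(ℚ_v)` divisible by every power of `p` is torsion -/

section Local

variable (W : WeierstrassCurve ℚ) [W.IsElliptic] [W.IsGloballyMinimal] (p : ℕ) [hp : Fact p.Prime]

/-- **A point of `E(ℚ_v)` (`v` the place above `p`) that is `p^k`-divisible for EVERY `k` is torsion**: read through the
logarithm `λ : E(ℚ_v) → ℚ_p` (kernel = torsion, image `ℤ_p·ϖ`, `LocPKummer.exists_lambda_adicCompletion`), the coordinate
of `λ R` lies in `⋂_k p^k ℤ_p = 0`. [cite: SilvermanAEC2009, IV.6.4 and VII.6.3] -/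
theorem isOfFinAddOrder_of_forall_exists_zsmul_eq
    {R : (W.baseChange ((primePlace p).adicCompletion ℚ)).toAffine.Point}
    (hR : ∀ k : ℕ, ∃ S : (W.baseChange ((primePlace p).adicCompletion ℚ)).toAffine.Point, ((p : ℤ) ^ k) • S = R) :
    IsOfFinAddOrder R := by
  obtain ⟨lam, ϖ, hϖ, -, hrange, hker⟩ := LocPKummer.exists_lambda_adicCompletion W p
  obtain ⟨a, ha⟩ := LocPKummer.exists_coe_mul_eq lam hrange R
  -- `a ∈ p^k ℤ_p` for every `k`
  have hmem : ∀ k : ℕ, a ∈ (Ideal.span {(p : ℤ_[p]) ^ k} : Ideal ℤ_[p]) := by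
    intro k
    obtain ⟨S, hS⟩ := hR k
    obtain ⟨b, hb⟩ := LocPKummer.exists_coe_mul_eq lam hrange S
    have h : (a : ℚ_[p]) * ϖ = (((p : ℤ_[p]) ^ k * b : ℤ_[p]) : ℚ_[p]) * ϖ := by
      rw [ha, ← hS, map_zsmul, ← hb, PadicInt.coe_mul, PadicInt.coe_pow, PadicInt.coe_natCast, zsmul_eq_mul,
        Int.cast_pow, Int.cast_natCast, mul_assoc]
    have hab : a = (p : ℤ_[p]) ^ k * b := Subtype.ext (mul_right_cancel₀ hϖ h)
    rw [hab]
    exact Ideal.mul_mem_right _ _ (Ideal.mem_span_singleton_self _)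
  have ha0 : a = 0 := eq_zero_of_forall_mem_span_pow hmem
  rw [← hker R, ← ha, ha0, PadicInt.coe_zero, zero_mul]

end Local

/-! ## §3 Non-zero Kummer logarithm ⟹ infinite order -/

section Global

variable (W : WeierstrassCurve ℚ) [W.IsElliptic] [W.IsGloballyMinimal] (p : ℕ) [hp : Fact p.Prime]
  [ContinuousSMul ℤ_[p] (W.tateModule p)]

/-- **`HasLocPKummerLog W p x t` with `t ≠ 0` forces `x ∈ H¹(ℚ, T_pW)` to have INFINITE order.** If `n • x = 0` then the
witness point `Q` of the Kummer logarithm satisfies `κ_k(n•Q) = loc_p(m•n•x) = 0` at every level, so `n•Q` is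
`p^k`-divisible in `E(ℚ_v)` for every `k` (`ker_localKummerMap`), hence torsion (§2); then `log_ω Q = 0 = m·t` with
`m ≠ 0`. [cite: BlochKato1990, Ex. 3.11] [cite: SilvermanAEC2009, VIII.§2 and IV.6.4]
[cite: AlpogeBhargavaShnidman2022, App. A §10.1.2–§10.1.3 (pp. 33–34)] -/
theorem not_isOfFinAddOrder_of_hasLocPKummerLog_ne_zero (x : H1 (tateRep W p) ⊤) {t : ℚ_[p]}
    (ht : HasLocPKummerLog W p x t) (ht0 : t ≠ 0) : ¬ IsOfFinAddOrder x := by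
  intro hfin
  obtain ⟨n, hn, hnx⟩ := hfin.exists_nsmul_eq_zero
  obtain ⟨m, Q, hm, hk, hlog⟩ := ht
  set Q' := WeierstrassCurve.Affine.Point.map (padicToAdic p) Q with hQ'
  -- `n • Q'` is `p^k`-divisible for every `k`
  have hdiv : ∀ k : ℕ, ∃ S : (W.baseChange ((primePlace p).adicCompletion ℚ)).toAffine.Point,
      ((p : ℤ) ^ k) • S = n • Q' := by
    intro k
    have hpk : ((p : ℤ) ^ k) ≠ 0 := pow_ne_zero k (Int.natCast_ne_zero.mpr hp.out.ne_zero)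
    have hmem : n • Q' ∈ (W.localKummerMap ((primePlace p).adicCompletion ℚ) hpk).ker := by
      rw [AddMonoidHom.mem_ker, map_nsmul, hQ', ← hk k, ← map_nsmul, smul_comm, hnx, smul_zero, map_zero]
    -- (the `CharZero` instance is introduced only now, to keep `ℚ`-algebra instances on `ℚ_v` coherent above)
    haveI : CharZero ((primePlace p).adicCompletion ℚ) :=
      charZero_of_injective_algebraMap (algebraMap ℚ ((primePlace p).adicCompletion ℚ)).injective
    rw [ker_localKummerMap] at hmem
    obtain ⟨S, hS⟩ := hmem
    exact ⟨S, hS⟩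
  have htorsQ' : IsOfFinAddOrder (n • Q') := isOfFinAddOrder_of_forall_exists_zsmul_eq W p hdiv
  -- hence `Q'`, hence `Q`, is torsion
  have hQ'fin : IsOfFinAddOrder Q' := by
    obtain ⟨N, hN, hNQ⟩ := htorsQ'.exists_nsmul_eq_zero
    exact isOfFinAddOrder_iff_nsmul_eq_zero.mpr ⟨n * N, Nat.mul_pos hn hN, by rw [mul_nsmul, hNQ]⟩
  have hQfin : IsOfFinAddOrder Q :=
    (WeierstrassCurve.Affine.Point.map_injective (padicToAdic p)).isOfFinAddOrder_iff
      (f := WeierstrassCurve.Affine.Point.map (padicToAdic p)) |>.mp hQ'fin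
  -- `log_ω Q = 0`, contradiction with `m·t ≠ 0`
  have hlog0 := CongruentShaFreeCutKatoKummerLogTorsion.padicLogLocal_eq_zero_of_isOfFinAddOrder W p hQfin
  rw [hlog] at hlog0
  exact mul_ne_zero (Nat.cast_ne_zero.mpr hm) ht0 hlog0

/-- **Bottom-layer form.** For a `ℤ_p`-extension `κ`, a pinned Iwasawa cohomology `I : IwasawaH1Data W p κ γ` and
`z₀ ∈ 𝐇¹_Γ(T_pW)`: if the bottom layer `layerZeroToTop (I.proj 0 z₀)` has a Kummer logarithm `t ≠ 0`, then
`I.proj 0 z₀` has INFINITE order — the hypothesis `hnt` of the rank-one descent theorems P1/P1′ and of the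
`𝐇²_Γ`-coinvariant index, in the currency of S1Λ's `bottomClass`. [cite: Kato2004Asterisque, §14.14 (14.14.1) (p. 243)]
[cite: BlochKato1990, Ex. 3.11] -/
theorem not_isOfFinAddOrder_proj_zero_of_hasLocPKummerLog_ne_zero (κ : ZpExtension ℚ p)
    {γ : absoluteGaloisGroup ℚ} (I : IwasawaH1Data W p κ γ) (z₀ : I.H) {t : ℚ_[p]}
    (ht : HasLocPKummerLog W p (layerZeroToTop W p κ (I.proj 0 z₀)) t) (ht0 : t ≠ 0) :
    ¬ IsOfFinAddOrder (I.proj 0 z₀) := by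
  intro hfin
  refine not_isOfFinAddOrder_of_hasLocPKummerLog_ne_zero W p _ ht ht0 ?_
  obtain ⟨n, hn, hnx⟩ := hfin.exists_nsmul_eq_zero
  refine isOfFinAddOrder_iff_nsmul_eq_zero.mpr ⟨n, hn, ?_⟩
  rw [← map_nsmul, hnx, map_zero]

end Global

end Summit.BirchSwinnertonDyer.BirchSwinnertonDyer.Theorems.ErratumRoadFiveKatoFframeKummerLogNonTorsion

end
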